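import Mathlib
import Summits.AtomisticToContinuum.BoseEinsteinCondensation.Theses.BECLiebAntibunching

/-!
# Crux `HardCorePalmAffinity` (stmt-AtomisticToContinuum-10241) — birth skeleton `Lines/birth.lean`

Route `BECLiebAntibunching` (also wanted verbatim by `BECRieszShadow`; sibling `HardCoreAffinity` of
`BECRiccatiGhostPlasma`). Line **void-conditioned Palm–Jensen** — the route's own foreseen split (iii)
`HardCoreApproximants → VoidConditionedJensen → HardCorePalmAffinity`, with the VOID BOUND supplied by
anti-bunching of the approximant exactly as the crux docstring says
(`γ(x,y)/ρ ≥ P_x(A_y)·exp(−E[Δ | A_y])`, `P_x(A_y) ≥ 1 − (4π/3)ρa³ sup g₂`).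

Notation (informal). For a nonnegative periodic `C¹` state `Ψ` of `n+1` bosons on the torus of side
`L`, a tagged position `x` and bath `Y ∈ cell^n`: Palm weight `p_x(Y) = |Ψ(x,Y)|²`, slice mass
`m_x = ∫_{cell^n} p_x`, UNCOVERED EVENT `U_a(y) = {Y : |Y_j − y − Lm| > a for all j, all m ∈ ℤ³}`
(no bath particle within torus distance `a` of `y`).

* `stub_voidConditionedJensen` (analysis, provable now, size M): Jensen for `exp` under the Palm law
  RESTRICTED to an event `A`: if `p_x(A) ≥ θ·m_x`, `p_x > 0 ⇒ p_y > 0` on `A`, and the conditional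
  entropy `∫_A p_x log(p_x/p_y) ≤ K·m_x` (integrand integrable), then
  `m_x ≤ θ⁻¹ e^{K/(2θ)} ∫ |Ψ(x,Y)||Ψ(y,Y)| dY` — the affinity inequality of the crux with
  `C = −log θ + K/(2θ)`. (`∫_A √(p_x p_y) = p_x(A)·E[√(p_y/p_x) | A] ≥ p_x(A)·exp(−KL_A/2)`.)
* `stub_voidBoundOfPalmIntensity` (measure theory + lattice tiling, provable now, size M): a bound
  `B/L³` on the one-particle Palm intensity (`p_x{Y_j ∈ S} ≤ (B/L³)|S|·m_x` for every measurable
  `S ⊆ ℝ³` and every `j`) gives the void bound `p_x(U_a(y)) ≥ (1 − n(B/L³)(4π/3)a³)·m_x`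
  (union bound over `j`; the periodic ball meets the cell in measure `≤ (4π/3)a³` because the
  translates `cell − Lm` tile `ℝ³`). This is "anti-bunching of the approximant supplies the void
  bound" (`sup g₂ ≤ B`).
* `stub_hardCoreVoidEntropyWitness` (the hard-core physics; open, crux-strength but in the
  ENTROPY/VOID currency, size XL): for an UNBOUNDED admissible `v` and `ρ < ρ₀(v)` there are
  `a > 0` (exclusion radius: hard-core diameter plus a margin), `B ≥ 0` with `B(4π/3)a³ρ ≤ 1/2`,
  `K ≥ 0`, such that eventually in `n`, for every `δ > 0`, some nonnegative `C¹` δ-near-minimiser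
  `Ψ` (a smoothed cut-off of the Lipschitz hard-core ground state) has (i) Palm intensity `≤ B/L³`
  (sup-form anti-bunching of the approximant, `B = sup g₂ ≤ 2` expected), (ii) positivity transfer
  on the uncovered event (`Ψ(x,Y) ≠ 0 ⇒ Ψ(y,Y) ≠ 0` for `Y ∈ U_a(y)`: the dilute component of the
  torus hard-sphere configuration space is connected), (iii) the void-conditioned entropy bound
  `∫_{U_a(y)} p_x log(p_x/p_y) ≤ K m_x` uniformly in `x, y, n, δ` (the ODLRO-strength input; the
  contact singularity `log(1/(r−a))` is integrable against `p_x`, so `K < ∞` at each `n`).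
* `HardCorePalmAffinity_of` (kernel-checked composition, complete proof): `θ := 1/2`; the density
  bookkeeping `n(B/L³)(4π/3)a³ ≤ B(4π/3)a³·(n+1)/L³ = B(4π/3)a³ρ ≤ 1/2`
  (`div_sideLength_pow_three`), measurability of `U_a(y)`, and `C := −log(1/2) + K/(2·(1/2))`.

Disproof used: none — no `Disproof.lean` / Negative lemma is filed on this crux (`ledger crux ls`
2026-08-17: no workfiles); `ledger negatives` for the summit contains no Palm/affinity statement.
Typing checklist 4c: (ii) every Bochner integral of the log-ratio carries an `IntegrableOn` binder;
(iv) the only threshold is the structural `θ = 1/2` produced by `∃ a B` with `B(4π/3)a³ρ ≤ 1/2`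
(weakest form the assembly needs: any `θ > 0` would do, `1/2` fixes the constant).
-/

namespace Summit.AtomisticToContinuum.BoseEinsteinCondensation.Cruxes.HardCorePalmAffinity.Birth

open MeasureTheory Filter
open scoped ENNReal NNReal
open Literature.MathematicalPhysics.QuantumManyBody.BoseGas

/-- **Stub 1 — void-conditioned Palm–Jensen** (analysis; provable now; size M).
For a periodic `C¹` state `Ψ` of `n+1` bosons, positions `x y` and a measurable bath event `A`:
if on `A` positivity transfers (`Ψ(x,Y) ≠ 0 ⇒ Ψ(y,Y) ≠ 0`), the Palm mass of `A` is at least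
`θ·m_x` (`m_x = ∫_{cell^n}|Ψ(x,Y)|²`), and the conditional entropy
`∫_{cell^n ∩ A}|Ψ(x,Y)|² log(|Ψ(x,Y)|²/|Ψ(y,Y)|²) dY ≤ K·m_x` with an integrable integrand, then the
affinity inequality of the crux holds with `C = −log θ + K/(2θ)`:
`m_x ≤ θ⁻¹e^{K/(2θ)} ∫_{cell^n}|Ψ(x,Y)||Ψ(y,Y)| dY`.
Why true: Jensen for `exp` under the probability law `p_x|_A/p_x(A)` gives
`∫_A √(p_x p_y) ≥ p_x(A)·exp(−(2p_x(A))⁻¹∫_A p_x log(p_x/p_y)) ≥ θ m_x e^{−K/(2θ)}` (`K ≥ 0`,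
`p_x(A) ≥ θ m_x`); where `p_x = 0` the integrand is `0` by `Real.log` conventions, and `p_y > 0`
wherever `p_x > 0` on `A` by hypothesis, so no junk value enters. Edge cases: `m_x = 0` trivial;
`θ > 1` forces `m_x = 0`.
Leans on: `ConvexOn.map_integral_le` / `Real.add_pow_le_pow_mul_pow_of_nonneg`-free Jensen
(`MeasureTheory.ConvexOn.map_average_le`, `Real.convexOn_exp`), `lintegral`↔`integral` conversion
(`MeasureTheory.ofReal_integral_eq_lintegral_ofReal`), boundedness of a continuous periodic `Ψ`
on `cellN` (`Literature…exists_bound_on_cellN`). Generalises the route support `PalmJensen`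
(stmt-9162: the case `A = univ`, `θ = 1`, `Ψ > 0`). -/
theorem stub_voidConditionedJensen :
    ∀ (n : ℕ) (L θ K : ℝ) (Ψ : PeriodicTrialState (n + 1) L) (x y : Space) (A : Set (Config n)),
      0 < L → 0 < θ → 0 ≤ K → MeasurableSet A →
      (∀ Y ∈ A, Ψ.ψ (Matrix.vecCons x Y) ≠ 0 → Ψ.ψ (Matrix.vecCons y Y) ≠ 0) →
      IntegrableOn (fun Y : Config n => ‖Ψ.ψ (Matrix.vecCons x Y)‖ ^ 2 *
          Real.log (‖Ψ.ψ (Matrix.vecCons x Y)‖ ^ 2 / ‖Ψ.ψ (Matrix.vecCons y Y)‖ ^ 2))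
        (cellN n L ∩ A) →
      ENNReal.ofReal θ * ∫⁻ Y in cellN n L, (‖Ψ.ψ (Matrix.vecCons x Y)‖₊ : ℝ≥0∞) ^ 2 ≤
          ∫⁻ Y in cellN n L ∩ A, (‖Ψ.ψ (Matrix.vecCons x Y)‖₊ : ℝ≥0∞) ^ 2 →
      ∫ Y in cellN n L ∩ A, ‖Ψ.ψ (Matrix.vecCons x Y)‖ ^ 2 *
          Real.log (‖Ψ.ψ (Matrix.vecCons x Y)‖ ^ 2 / ‖Ψ.ψ (Matrix.vecCons y Y)‖ ^ 2) ≤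
        K * ∫ Y in cellN n L, ‖Ψ.ψ (Matrix.vecCons x Y)‖ ^ 2 →
      ∫⁻ Y in cellN n L, (‖Ψ.ψ (Matrix.vecCons x Y)‖₊ : ℝ≥0∞) ^ 2 ≤
        ENNReal.ofReal (Real.exp (-Real.log θ + K / (2 * θ))) *
          ∫⁻ Y in cellN n L, (‖Ψ.ψ (Matrix.vecCons x Y)‖₊ : ℝ≥0∞) * (‖Ψ.ψ (Matrix.vecCons y Y)‖₊ : ℝ≥0∞) := by
  sorry

/-- **Stub 2 — anti-bunching of the approximant supplies the void bound** (measure theory +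
lattice tiling; provable now; size M). If the one-particle Palm intensity of `Ψ(x,·)²` is bounded by
`B/L³` — `∫_{cell^n ∩ {Y_j ∈ S}}|Ψ(x,Y)|² ≤ (B/L³)|S|·m_x` for every bath index `j` and measurable
`S ⊆ ℝ³` (sup-form pair density `g₂ ≤ B`) — then the UNCOVERED EVENT
`U_a(y) = {Y : a < |Y_j − y − Lm| ∀ j, ∀ m ∈ ℤ³}` has Palm mass `≥ (1 − n(B/L³)(4π/3)a³)·m_x`.
Why true: `cell^n \ U_a(y) ⊆ ⋃_j {Y_j ∈ cell ∩ ⋃_m closedBall(y+Lm, a)}`; union bound over the `n`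
indices; `|cell ∩ ⋃_m closedBall(y+Lm,a)| ≤ Σ_m |(cell − Lm) ∩ closedBall(y,a)| = (4π/3)a³` because
the translates of the half-open cell `[0,L)³` tile `ℝ³`; `ENNReal` subtraction (`ofReal (1−t) = 0`
when `t ≥ 1`, so no side condition on `a` versus `L`).
Leans on: `MeasureTheory.lintegral_iUnion_le`, `MeasureTheory.measure_iUnion_le`,
`EuclideanSpace.volume_ball`/`InnerProductSpace.volume_closedBall` in dimension 3,
`Literature…latticeVec`, `Literature…measurableSet_cell`, `Literature…volume_cell`. -/
theorem stub_voidBoundOfPalmIntensity :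
    ∀ (n : ℕ) (L a B : ℝ) (Ψ : PeriodicTrialState (n + 1) L) (x y : Space),
      0 < L → 0 < a → 0 ≤ B →
      (∀ (j : Fin n) (S : Set Space), MeasurableSet S →
        ∫⁻ Y in cellN n L ∩ {Z : Config n | Z j ∈ S}, (‖Ψ.ψ (Matrix.vecCons x Y)‖₊ : ℝ≥0∞) ^ 2 ≤
          ENNReal.ofReal (B / L ^ 3) * volume S *
            ∫⁻ Y in cellN n L, (‖Ψ.ψ (Matrix.vecCons x Y)‖₊ : ℝ≥0∞) ^ 2) →
      ENNReal.ofReal (1 - (n : ℝ) * (B / L ^ 3) * (4 / 3 * Real.pi * a ^ 3)) *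
          ∫⁻ Y in cellN n L, (‖Ψ.ψ (Matrix.vecCons x Y)‖₊ : ℝ≥0∞) ^ 2 ≤
        ∫⁻ Y in cellN n L ∩ {Z : Config n | ∀ (j : Fin n) (m : Fin 3 → ℤ), a < ‖Z j - y - latticeVec L m‖},
          (‖Ψ.ψ (Matrix.vecCons x Y)‖₊ : ℝ≥0∞) ^ 2 := by
  sorry

/-- **Stub 3 — hard-core void/entropy witness** (the physics of the crux in the entropy–void
currency; open; size XL; load-bearing). For every UNBOUNDED admissible `v` (hard spheres, hard core
plus tail, unbounded soft cores) there is `ρ₀ > 0` such that for `0 < ρ < ρ₀` there are an exclusion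
radius `a > 0`, an intensity bound `B ≥ 0` with `B(4π/3)a³ρ ≤ 1/2`, and `K ≥ 0` such that,
eventually in `n` and for every `δ > 0`, some nonnegative periodic `C¹` δ-near-minimiser `Ψ` of
`n+1` bosons on the torus of side `L = ((n+1)/ρ)^{1/3}` satisfies, for all `x, y`:
(i) Palm intensity `≤ B/L³` (sup-form anti-bunching of the approximant, `B = sup g₂`; `B ≤ 2`
expected for dilute hard spheres, IsiharaYee1964 / GiorginiBoronatCasulleras1999);
(ii) positivity transfer on the uncovered event `U_a(y)` (`Ψ(x,Y) ≠ 0 ⇒ Ψ(y,Y) ≠ 0`: with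
`a = a_hc + margin` and `Ψ` a smoothed cut-off of the Lipschitz ground state supported in the dilute
component of the torus hard-sphere configuration space — the connectivity input the route flags under
PeriodicRigidity);
(iii) the VOID-CONDITIONED ENTROPY BOUND `∫_{cell^n ∩ U_a(y)} p_x log(p_x/p_y) ≤ K·m_x` with an
integrable integrand (the contact zero `Ψ ∼ dist − a_hc` gives only a `log(1/(r−a_hc))`
singularity, integrable against `p_x`; uniformity of `K` in `n` is the ODLRO-strength content —
the hard-core analogue of `NonPairwisePalmMean` + freed pair part, LSSY2005 Ch. 5 open problem).
Why it might fail: `K` uniform in `n` is conjunct-strength; jammed/caged components could break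
(ii) if not excluded by the choice of support; `a, B, K` must serve all `δ → 0` at once (they may
depend on `ρ` but not on `n, δ`). Sources: LSSY2005 §1.2/Ch. 5, Reatto1969, PenroseOnsager1956,
KalosLevesqueVerlet1974, GiorginiBoronatCasulleras1999, BaryshnikovBubenikKahle2013. -/
theorem stub_hardCoreVoidEntropyWitness :
    ∀ v : ℝ → ℝ≥0∞, IsRepulsiveFiniteRange v → (¬ ∃ M : NNReal, ∀ r, v r ≤ M) →
      ∃ ρ₀ : ℝ, 0 < ρ₀ ∧ ∀ ρ : ℝ, 0 < ρ → ρ < ρ₀ →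
        ∃ a B K : ℝ, 0 < a ∧ 0 ≤ B ∧ 0 ≤ K ∧ B * (4 / 3 * Real.pi * a ^ 3) * ρ ≤ 1 / 2 ∧
        ∀ᶠ n : ℕ in Filter.atTop, ∀ δ : ℝ≥0∞, 0 < δ →
          ∃ Ψ : PeriodicTrialState (n + 1) (sideLength ρ (n + 1)),
            periodicEnergy v Ψ ≤ periodicGroundStateEnergy v (n + 1) (sideLength ρ (n + 1)) + δ ∧
            (∀ X, Ψ.ψ X = (‖Ψ.ψ X‖ : ℂ)) ∧
            (∀ (x : Space) (j : Fin n) (S : Set Space), MeasurableSet S →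
              ∫⁻ Y in cellN n (sideLength ρ (n + 1)) ∩ {Z : Config n | Z j ∈ S},
                  (‖Ψ.ψ (Matrix.vecCons x Y)‖₊ : ℝ≥0∞) ^ 2 ≤
                ENNReal.ofReal (B / sideLength ρ (n + 1) ^ 3) * volume S *
                  ∫⁻ Y in cellN n (sideLength ρ (n + 1)), (‖Ψ.ψ (Matrix.vecCons x Y)‖₊ : ℝ≥0∞) ^ 2) ∧
            ∀ x y : Space,
              (∀ Y ∈ {Z : Config n | ∀ (j : Fin n) (m : Fin 3 → ℤ),
                  a < ‖Z j - y - latticeVec (sideLength ρ (n + 1)) m‖},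
                Ψ.ψ (Matrix.vecCons x Y) ≠ 0 → Ψ.ψ (Matrix.vecCons y Y) ≠ 0) ∧
              IntegrableOn (fun Y : Config n => ‖Ψ.ψ (Matrix.vecCons x Y)‖ ^ 2 *
                  Real.log (‖Ψ.ψ (Matrix.vecCons x Y)‖ ^ 2 / ‖Ψ.ψ (Matrix.vecCons y Y)‖ ^ 2))
                (cellN n (sideLength ρ (n + 1)) ∩ {Z : Config n | ∀ (j : Fin n) (m : Fin 3 → ℤ),
                  a < ‖Z j - y - latticeVec (sideLength ρ (n + 1)) m‖}) ∧
              ∫ Y in cellN n (sideLength ρ (n + 1)) ∩ {Z : Config n | ∀ (j : Fin n) (m : Fin 3 → ℤ),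
                  a < ‖Z j - y - latticeVec (sideLength ρ (n + 1)) m‖},
                  ‖Ψ.ψ (Matrix.vecCons x Y)‖ ^ 2 *
                    Real.log (‖Ψ.ψ (Matrix.vecCons x Y)‖ ^ 2 / ‖Ψ.ψ (Matrix.vecCons y Y)‖ ^ 2) ≤
                K * ∫ Y in cellN n (sideLength ρ (n + 1)), ‖Ψ.ψ (Matrix.vecCons x Y)‖ ^ 2 := by
  sorry

/-! ## Registered stub statements
Name-keyed statement aliases (`Registered.stub_<name> : Prop`, verbatim the types of the `stub_*` theorems
above): the skeleton audit `#h21_check_skeleton` admits a hypothesis of the composition iff its head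
constant is a declared stub BY NAME, and crux workfiles may not carry the gate-reserved `@[stub]` tag, so
the composition below is typed over these aliases (pattern of
`Cruxes/ShadowDensityVanishes/Lines/x1_monofractal_amplification.lean`). -/
namespace Registered

/-- registered statement of `stub_voidConditionedJensen` (verbatim its type). -/
abbrev stub_voidConditionedJensen : Prop :=
    ∀ (n : ℕ) (L θ K : ℝ) (Ψ : PeriodicTrialState (n + 1) L) (x y : Space) (A : Set (Config n)),
      0 < L → 0 < θ → 0 ≤ K → MeasurableSet A →
      (∀ Y ∈ A, Ψ.ψ (Matrix.vecCons x Y) ≠ 0 → Ψ.ψ (Matrix.vecCons y Y) ≠ 0) →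
      IntegrableOn (fun Y : Config n => ‖Ψ.ψ (Matrix.vecCons x Y)‖ ^ 2 *
          Real.log (‖Ψ.ψ (Matrix.vecCons x Y)‖ ^ 2 / ‖Ψ.ψ (Matrix.vecCons y Y)‖ ^ 2))
        (cellN n L ∩ A) →
      ENNReal.ofReal θ * ∫⁻ Y in cellN n L, (‖Ψ.ψ (Matrix.vecCons x Y)‖₊ : ℝ≥0∞) ^ 2 ≤
          ∫⁻ Y in cellN n L ∩ A, (‖Ψ.ψ (Matrix.vecCons x Y)‖₊ : ℝ≥0∞) ^ 2 →
      ∫ Y in cellN n L ∩ A, ‖Ψ.ψ (Matrix.vecCons x Y)‖ ^ 2 *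
          Real.log (‖Ψ.ψ (Matrix.vecCons x Y)‖ ^ 2 / ‖Ψ.ψ (Matrix.vecCons y Y)‖ ^ 2) ≤
        K * ∫ Y in cellN n L, ‖Ψ.ψ (Matrix.vecCons x Y)‖ ^ 2 →
      ∫⁻ Y in cellN n L, (‖Ψ.ψ (Matrix.vecCons x Y)‖₊ : ℝ≥0∞) ^ 2 ≤
        ENNReal.ofReal (Real.exp (-Real.log θ + K / (2 * θ))) *
          ∫⁻ Y in cellN n L, (‖Ψ.ψ (Matrix.vecCons x Y)‖₊ : ℝ≥0∞) * (‖Ψ.ψ (Matrix.vecCons y Y)‖₊ : ℝ≥0∞)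

/-- registered statement of `stub_voidBoundOfPalmIntensity` (verbatim its type). -/
abbrev stub_voidBoundOfPalmIntensity : Prop :=
    ∀ (n : ℕ) (L a B : ℝ) (Ψ : PeriodicTrialState (n + 1) L) (x y : Space),
      0 < L → 0 < a → 0 ≤ B →
      (∀ (j : Fin n) (S : Set Space), MeasurableSet S →
        ∫⁻ Y in cellN n L ∩ {Z : Config n | Z j ∈ S}, (‖Ψ.ψ (Matrix.vecCons x Y)‖₊ : ℝ≥0∞) ^ 2 ≤
          ENNReal.ofReal (B / L ^ 3) * volume S *
            ∫⁻ Y in cellN n L, (‖Ψ.ψ (Matrix.vecCons x Y)‖₊ : ℝ≥0∞) ^ 2) →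
      ENNReal.ofReal (1 - (n : ℝ) * (B / L ^ 3) * (4 / 3 * Real.pi * a ^ 3)) *
          ∫⁻ Y in cellN n L, (‖Ψ.ψ (Matrix.vecCons x Y)‖₊ : ℝ≥0∞) ^ 2 ≤
        ∫⁻ Y in cellN n L ∩ {Z : Config n | ∀ (j : Fin n) (m : Fin 3 → ℤ), a < ‖Z j - y - latticeVec L m‖},
          (‖Ψ.ψ (Matrix.vecCons x Y)‖₊ : ℝ≥0∞) ^ 2

/-- registered statement of `stub_hardCoreVoidEntropyWitness` (verbatim its type). -/
abbrev stub_hardCoreVoidEntropyWitness : Prop :=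
    ∀ v : ℝ → ℝ≥0∞, IsRepulsiveFiniteRange v → (¬ ∃ M : NNReal, ∀ r, v r ≤ M) →
      ∃ ρ₀ : ℝ, 0 < ρ₀ ∧ ∀ ρ : ℝ, 0 < ρ → ρ < ρ₀ →
        ∃ a B K : ℝ, 0 < a ∧ 0 ≤ B ∧ 0 ≤ K ∧ B * (4 / 3 * Real.pi * a ^ 3) * ρ ≤ 1 / 2 ∧
        ∀ᶠ n : ℕ in Filter.atTop, ∀ δ : ℝ≥0∞, 0 < δ →
          ∃ Ψ : PeriodicTrialState (n + 1) (sideLength ρ (n + 1)),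
            periodicEnergy v Ψ ≤ periodicGroundStateEnergy v (n + 1) (sideLength ρ (n + 1)) + δ ∧
            (∀ X, Ψ.ψ X = (‖Ψ.ψ X‖ : ℂ)) ∧
            (∀ (x : Space) (j : Fin n) (S : Set Space), MeasurableSet S →
              ∫⁻ Y in cellN n (sideLength ρ (n + 1)) ∩ {Z : Config n | Z j ∈ S},
                  (‖Ψ.ψ (Matrix.vecCons x Y)‖₊ : ℝ≥0∞) ^ 2 ≤
                ENNReal.ofReal (B / sideLength ρ (n + 1) ^ 3) * volume S *
                  ∫⁻ Y in cellN n (sideLength ρ (n + 1)), (‖Ψ.ψ (Matrix.vecCons x Y)‖₊ : ℝ≥0∞) ^ 2) ∧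
            ∀ x y : Space,
              (∀ Y ∈ {Z : Config n | ∀ (j : Fin n) (m : Fin 3 → ℤ),
                  a < ‖Z j - y - latticeVec (sideLength ρ (n + 1)) m‖},
                Ψ.ψ (Matrix.vecCons x Y) ≠ 0 → Ψ.ψ (Matrix.vecCons y Y) ≠ 0) ∧
              IntegrableOn (fun Y : Config n => ‖Ψ.ψ (Matrix.vecCons x Y)‖ ^ 2 *
                  Real.log (‖Ψ.ψ (Matrix.vecCons x Y)‖ ^ 2 / ‖Ψ.ψ (Matrix.vecCons y Y)‖ ^ 2))
                (cellN n (sideLength ρ (n + 1)) ∩ {Z : Config n | ∀ (j : Fin n) (m : Fin 3 → ℤ),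
                  a < ‖Z j - y - latticeVec (sideLength ρ (n + 1)) m‖}) ∧
              ∫ Y in cellN n (sideLength ρ (n + 1)) ∩ {Z : Config n | ∀ (j : Fin n) (m : Fin 3 → ℤ),
                  a < ‖Z j - y - latticeVec (sideLength ρ (n + 1)) m‖},
                  ‖Ψ.ψ (Matrix.vecCons x Y)‖ ^ 2 *
                    Real.log (‖Ψ.ψ (Matrix.vecCons x Y)‖ ^ 2 / ‖Ψ.ψ (Matrix.vecCons y Y)‖ ^ 2) ≤
                K * ∫ Y in cellN n (sideLength ρ (n + 1)), ‖Ψ.ψ (Matrix.vecCons x Y)‖ ^ 2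

end Registered

/-- **Composition** (kernel-checked, complete proof): the three stubs imply the crux
`BECLiebAntibunching.HardCorePalmAffinity` BY NAME. Real content of the glue: `θ := 1/2` is a void
fraction because `n(B/L³)(4π/3)a³ ≤ B(4π/3)a³(n+1)/L³ = B(4π/3)a³ρ ≤ 1/2`
(`div_sideLength_pow_three`); the uncovered event is measurable; `C := −log(1/2) + K/(2·(1/2))`.
Hypotheses are the registered stub statements by name (`Registered.stub_*`, verbatim the `stub_*` types). -/
theorem HardCorePalmAffinity_of (hJ : Registered.stub_voidConditionedJensen)
    (hV : Registered.stub_voidBoundOfPalmIntensity) (hW : Registered.stub_hardCoreVoidEntropyWitness) :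
    Summit.AtomisticToContinuum.BoseEinsteinCondensation.Theses.BECLiebAntibunching.HardCorePalmAffinity := by
  intro v hv hunb
  obtain ⟨ρ₀, hρ₀, hmain⟩ := hW v hv hunb
  refine ⟨ρ₀, hρ₀, fun ρ hρ hρlt => ?_⟩
  obtain ⟨a, B, K, ha, hB, hK, hsmall, hev⟩ := hmain ρ hρ hρlt
  refine ⟨-Real.log (1 / 2) + K / (2 * (1 / 2)), ?_⟩
  filter_upwards [hev] with n hn
  intro δ hδ
  obtain ⟨Ψ, hE, hnn, hI, hxy⟩ := hn δ hδ
  refine ⟨Ψ, hE, hnn, fun x y => ?_⟩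
  obtain ⟨hpos, hint, hent⟩ := hxy x y
  -- positivity of the side length and the density identity `(n+1)/L³ = ρ`
  have hL : 0 < sideLength ρ (n + 1) := by
    unfold sideLength
    exact Real.rpow_pos_of_pos (div_pos (Nat.cast_pos.mpr (Nat.succ_pos n)) hρ) _
  have hL3 : 0 < sideLength ρ (n + 1) ^ 3 := pow_pos hL 3
  have hρeq : ((n : ℝ) + 1) / sideLength ρ (n + 1) ^ 3 = ρ := by
    have h := div_sideLength_pow_three hρ (Nat.succ_pos n)
    push_cast at h
    exact h
  have hVol : 0 ≤ 4 / 3 * Real.pi * a ^ 3 := by positivity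
  -- density bookkeeping: n·(B/L³)·(4π/3)a³ ≤ B(4π/3)a³·ρ ≤ 1/2, hence θ := 1/2 is a void fraction
  have hkey : (n : ℝ) * (B / sideLength ρ (n + 1) ^ 3) * (4 / 3 * Real.pi * a ^ 3) ≤ 1 / 2 := by
    calc (n : ℝ) * (B / sideLength ρ (n + 1) ^ 3) * (4 / 3 * Real.pi * a ^ 3)
        = B * (4 / 3 * Real.pi * a ^ 3) * ((n : ℝ) / sideLength ρ (n + 1) ^ 3) := by ring
      _ ≤ B * (4 / 3 * Real.pi * a ^ 3) * (((n : ℝ) + 1) / sideLength ρ (n + 1) ^ 3) :=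
          mul_le_mul_of_nonneg_left (div_le_div_of_nonneg_right (by linarith) hL3.le)
            (mul_nonneg hB hVol)
      _ = B * (4 / 3 * Real.pi * a ^ 3) * ρ := by rw [hρeq]
      _ ≤ 1 / 2 := hsmall
  have harith :
      (1 : ℝ) / 2 ≤ 1 - (n : ℝ) * (B / sideLength ρ (n + 1) ^ 3) * (4 / 3 * Real.pi * a ^ 3) := by
    linarith
  -- the uncovered event is measurable (countable intersection of open sets)
  have hU : MeasurableSet {Z : Config n | ∀ (j : Fin n) (m : Fin 3 → ℤ),
      a < ‖Z j - y - latticeVec (sideLength ρ (n + 1)) m‖} := by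
    have hset : {Z : Config n | ∀ (j : Fin n) (m : Fin 3 → ℤ),
        a < ‖Z j - y - latticeVec (sideLength ρ (n + 1)) m‖} =
        ⋂ (j : Fin n), ⋂ (m : Fin 3 → ℤ),
          {Z : Config n | a < ‖Z j - y - latticeVec (sideLength ρ (n + 1)) m‖} := by
      ext Z
      simp only [Set.mem_setOf_eq, Set.mem_iInter]
    rw [hset]
    refine MeasurableSet.iInter fun j => MeasurableSet.iInter fun m => ?_
    exact (isOpen_lt continuous_const
      ((((continuous_apply j).sub continuous_const).sub continuous_const).norm)).measurableSet
  -- void bound from the Palm intensity bound (stub 2), at θ := 1/2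
  have hvoid := hV n (sideLength ρ (n + 1)) a B Ψ x y hL ha hB (hI x)
  have hvoid' : ENNReal.ofReal (1 / 2) *
      ∫⁻ Y in cellN n (sideLength ρ (n + 1)), (‖Ψ.ψ (Matrix.vecCons x Y)‖₊ : ℝ≥0∞) ^ 2 ≤
      ∫⁻ Y in cellN n (sideLength ρ (n + 1)) ∩ {Z : Config n | ∀ (j : Fin n) (m : Fin 3 → ℤ),
          a < ‖Z j - y - latticeVec (sideLength ρ (n + 1)) m‖},
        (‖Ψ.ψ (Matrix.vecCons x Y)‖₊ : ℝ≥0∞) ^ 2 :=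
    (mul_le_mul_left (ENNReal.ofReal_le_ofReal harith) _).trans hvoid
  -- void-conditioned Jensen (stub 1) with θ := 1/2, A := the uncovered event
  exact hJ n (sideLength ρ (n + 1)) (1 / 2) K Ψ x y _ hL (by norm_num) hK hU hpos hint hvoid' hent

/-- **The skeleton applied to its stubs** — the crux BY NAME with no hypotheses (its axiom closure
reaches `sorryAx` exactly through the three `stub_*` theorems; it becomes a proof of the crux the day the
stubs are proved). Also certifies in-kernel that each `stub_*` type is its `Registered.stub_*` alias. -/
theorem HardCorePalmAffinity_of_stubs :
    Summit.AtomisticToContinuum.BoseEinsteinCondensation.Theses.BECLiebAntibunching.HardCorePalmAffinity :=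
  HardCorePalmAffinity_of stub_voidConditionedJensen stub_voidBoundOfPalmIntensity
    stub_hardCoreVoidEntropyWitness

end Summit.AtomisticToContinuum.BoseEinsteinCondensation.Cruxes.HardCorePalmAffinity.Birth
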